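/-
Soloist `solo-ValiantsHypothesis-informed`, session 36 — the unbalanced (multiplier) product trick:
naming the multipliers of a bilinear realisation separately from the realising subspace turns the
product trick into a bound that is linear in `s = dim W` as soon as the multiplier space is small.
Consequence for the univariate window programme: hubs are light — any `o(k / log k)` multipliers
carry at most `(1 + o(1)) s` free monomials in total.
-/
import Mathlib
import Summits.ValiantsHypothesis.ValiantsHypothesis.Theorems.SoloInformedProductTrick
import Summits.ValiantsHypothesis.ValiantsHypothesis.Theorems.SoloInformedQuadSpanWindow

/-!
# The multiplier product trick: `C(|E|, k) ≤ C(v + k, k) · C(s + k, k)`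

Setting (soloist note `paper/quadspan.md`, item 2.72; the plain product trick is Proposition 7.72 =
`soloInformed_productTrick`).  `R` is a commutative algebra over a field `F`, `χ : ℕ → R` a
multiplicative, `F`-linearly independent system of monomials (`χ 0 = 1`, `χ (x+y) = χ x * χ y`; in
the univariate window programme `R = F[X]`, `χ e = X^e`), `E ⊂ ℕ` is `(2k, h)`-free with `h ≥ 1`
(`SoloNatFree (2k) h E`: no nontrivial integer relation with `≤ 2k` nonzero coefficients of size
`≤ h`), and every `χ e`, `e ∈ E`, is realised **bilinearly**: `χ e ∈ W + V·W` for two subspaces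
`V` ("multipliers", dimension `v`) and `W` (dimension `s`) of `R`.

**Theorem (`soloInformed_multiplierTrick_submodule`).**  `C(|E|, k) ≤ C(v+k, k) · C(s+k, k)`.

*Proof.*  For a `k`-subset `S ⊆ E`, `∏_{e ∈ S} χ e = χ(∑ S) ∈ (W + V·W)^k ⊆ V_{≤k} · W_{≤k}`, where
`V_{≤k}` (`W_{≤k}`) is the space of values of polynomials of degree `≤ k` in a basis of `V` (of `W`)
— dimension `≤ C(v+k,k)` (`≤ C(s+k,k)`) by stars and bars (`finrank_soloDegSpan_le`), and
`dim (M·N) ≤ dim M · dim N` (`solo_finrank_mul_le`).  Freeness to order `2k` makes `S ↦ ∑ S`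
injective on `k`-subsets (`solo_kSubsetSums_injOn_nat`), so the `C(|E|,k)` products are distinct
monomials, hence linearly independent.  ∎

The core statement `soloInformed_multiplierTrick` is phrased with generators
(`χ e ∈ soloDegSpan c 1 * soloDegSpan b 1`, `c : Fin v → R`, `b : Fin s → R`); the two univariate
corollaries are the forms used in the window programme:

* `soloInformed_multiplierTrick_pencils` : hubs `q_a`, `a ∈ B`, on one subspace `W ⊂ F[X]`,
  `q_a x = w + X^e` (`x, w ∈ W`) for every `e ∈ E`  ⟹  `C(|E|,k) ≤ C(|B|+k,k) · C(s+k,k)`;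
* `soloInformed_multiplierTrick_columns` : rank-2 columns `(p_a, q_a)`, `X^e = p_a x + q_a y`
  (`x, y ∈ W`)  ⟹  `C(|E|,k) ≤ C(2|B|+k,k) · C(s+k,k)`.

**Size.**  `C(N,k) ≤ C(v+k,k)·C(s+k,k)` gives `N ≤ k + (s+k)·C(v+k,k)^{1/k}`; for `v` fixed and
`k → ∞` this is `N ≤ (1 + O(v log k / k))·s`: at growing freeness order, ANY bounded (indeed any
`o(k / log k)`) set of hubs carries at most `(1+o(1))·s` free monomials IN TOTAL (the additive tools
gave `2s` for one multi-line hub, `SoloInformedRayGirth`, and `(1/2+o(1))s` per hub only on a common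
line, `SoloInformedPencilGirth`).  For `v ≫ k` it reads `N ≲ e·v·s/k`: realising `c·s^{3/2}` free
monomials needs multiplier dimension `v ≳ (k/e)·c·√s`.  Exact values (`work/s36/multbound.out`):
`s = 10⁴, k = 7`: `v = 2 → 1.35 s`, `v = 4 → 1.98 s`, `v = 200 → 0.60 s^{3/2}` (plain trick: `926 s`).

**Path to the summit and honest scope.**  The summit reduction in force is
`soloInformed_valiantsHypothesis_of_unipolyLogOrderBound` (`|E| ≤ C s^γ`, `γ < 3/2`, for free value
sets realised in the quadratic span of `s` polynomials, freeness order `log₂ s + 2`).  This file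
retires the hub-type adversaries of the dossier (u77 half pencils, u78 multi-line stars: `≍ √s`
hubs can carry only `O(s^{3/2}/k) = o(s^{3/2})` values at growing order) and shows that a
configuration with `c·s^{3/2}` free values must spread them over `≳ k√s` multipliers of average
load `O(s/k)`.  It does **not** bound such spread configurations (bushy blocks, question u75 of the
dossier): against `≍ s^{3/2}` light columns the inequality is vacuous, the wall `n → s` and the
exponent `3/2` are untouched, and no bound `|E| ≤ s^{2-δ}` for the quadratic span follows.
-/

namespace Summit.ValiantsHypothesis.ValiantsHypothesis.Theorems

open Finset Module
open scoped Pointwise Polynomial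

/-! ### Products of subspaces: degrees add, dimensions multiply -/

section MulSpan

variable {F : Type*} [Field F] {R : Type*} [CommRing R] [Algebra F R] {v s : ℕ}

/-- Products of bilinear values: `(V_a·W_d)·(V_{a'}·W_{d'}) ⊆ V_{a+a'}·W_{d+d'}` for the
degree filtrations `V_n = soloDegSpan c n`, `W_n = soloDegSpan b n`. -/
theorem solo_mul_mem_mulDegSpan (c : Fin v → R) (b : Fin s → R) {a a' d d' : ℕ} {x y : R}
    (hx : x ∈ soloDegSpan (F := F) c a * soloDegSpan (F := F) b d)
    (hy : y ∈ soloDegSpan (F := F) c a' * soloDegSpan (F := F) b d') :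
    x * y ∈ soloDegSpan (F := F) c (a + a') * soloDegSpan (F := F) b (d + d') := by
  have hxy : x * y ∈ (soloDegSpan (F := F) c a * soloDegSpan (F := F) c a') *
      (soloDegSpan (F := F) b d * soloDegSpan (F := F) b d') := by
    rw [← mul_mul_mul_comm]
    exact Submodule.mul_mem_mul hx hy
  have h1 : soloDegSpan (F := F) c a * soloDegSpan (F := F) c a' ≤ soloDegSpan (F := F) c (a + a') :=
    Submodule.mul_le.2 fun m hm n hn => mul_mem_soloDegSpan c hm hn
  have h2 : soloDegSpan (F := F) b d * soloDegSpan (F := F) b d' ≤ soloDegSpan (F := F) b (d + d') :=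
    Submodule.mul_le.2 fun m hm n hn => mul_mem_soloDegSpan b hm hn
  exact (Submodule.mul_le.2 fun m hm n hn => Submodule.mul_mem_mul (h1 hm) (h2 hn)) hxy

/-- A product of `|S|` bilinear values `f i ∈ V_1·W_1` lies in `V_{|S|}·W_{|S|}`. -/
theorem solo_prod_mem_mulDegSpan {ι : Type*} [DecidableEq ι] (c : Fin v → R) (b : Fin s → R)
    (f : ι → R) (S : Finset ι)
    (hf : ∀ i ∈ S, f i ∈ soloDegSpan (F := F) c 1 * soloDegSpan (F := F) b 1) :
    (∏ i ∈ S, f i) ∈ soloDegSpan (F := F) c S.card * soloDegSpan (F := F) b S.card := by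
  induction S using Finset.induction_on with
  | empty =>
    simpa using Submodule.mul_mem_mul (one_mem_soloDegSpan (F := F) c)
      (one_mem_soloDegSpan (F := F) b)
  | insert a S ha ih =>
    rw [prod_insert ha, card_insert_of_notMem ha]
    have h := solo_mul_mem_mulDegSpan c b (hf a (mem_insert_self a S))
      (ih fun i hi => hf i (mem_insert_of_mem hi))
    rwa [Nat.add_comm] at h

/-- `dim (M·N) ≤ dim M · dim N` for finite-dimensional subspaces of an algebra. -/
theorem solo_finrank_mul_le (M N : Submodule F R) [Module.Finite F M] [Module.Finite F N] :
    finrank F ↥(M * N) ≤ finrank F M * finrank F N := by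
  classical
  set bM := Module.finBasis F M with hbM
  set bN := Module.finBasis F N with hbN
  set SM : Finset R := Finset.univ.image (fun i => (bM i : R)) with hSM
  set SN : Finset R := Finset.univ.image (fun i => (bN i : R)) with hSN
  have hMle : M ≤ Submodule.span F (SM : Set R) := by
    intro y hy
    have hrepr := congrArg Subtype.val (bM.sum_repr ⟨y, hy⟩)
    simp only [Submodule.coe_sum, Submodule.coe_smul] at hrepr
    rw [← hrepr]
    exact Submodule.sum_mem _ fun i _ => Submodule.smul_mem _ _
      (Submodule.subset_span (by simp [hSM]))
  have hNle : N ≤ Submodule.span F (SN : Set R) := by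
    intro y hy
    have hrepr := congrArg Subtype.val (bN.sum_repr ⟨y, hy⟩)
    simp only [Submodule.coe_sum, Submodule.coe_smul] at hrepr
    rw [← hrepr]
    exact Submodule.sum_mem _ fun i _ => Submodule.smul_mem _ _
      (Submodule.subset_span (by simp [hSN]))
  have hle : M * N ≤ Submodule.span F ((SM * SN : Finset R) : Set R) := by
    rw [Finset.coe_mul, ← Submodule.span_mul_span]
    exact Submodule.mul_le.2 fun m hm n hn => Submodule.mul_mem_mul (hMle hm) (hNle hn)
  have h1 : finrank F (Submodule.span F ((SM * SN : Finset R) : Set R)) ≤ (SM * SN).card :=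
    finrank_span_finset_le_card (R := F) (SM * SN)
  have h2 : SM.card ≤ finrank F M := Finset.card_image_le.trans (by simp)
  have h3 : SN.card ≤ finrank F N := Finset.card_image_le.trans (by simp)
  calc finrank F ↥(M * N) ≤ finrank F (Submodule.span F ((SM * SN : Finset R) : Set R)) :=
        Submodule.finrank_mono hle
    _ ≤ (SM * SN).card := h1
    _ ≤ SM.card * SN.card := Finset.card_mul_le
    _ ≤ finrank F M * finrank F N := Nat.mul_le_mul h2 h3

/-- A finite-dimensional subspace lies in the degree-`≤ 1` values of its basis vectors. -/
theorem solo_le_soloDegSpan_finBasis (V : Submodule F R) [Module.Finite F V] :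
    V ≤ soloDegSpan (F := F) (fun i => (Module.finBasis F V i : R)) 1 := by
  intro y hy
  have hrepr := congrArg Subtype.val ((Module.finBasis F V).sum_repr ⟨y, hy⟩)
  simp only [Submodule.coe_sum, Submodule.coe_smul] at hrepr
  rw [← hrepr]
  refine Submodule.sum_mem _ fun i _ => Submodule.smul_mem _ _ ?_
  exact mem_soloDegSpan_of_aeval _ ⟨MvPolynomial.X i, (MvPolynomial.totalDegree_X (R := F) i).le,
    MvPolynomial.aeval_X _ i⟩

/-- `1` is a value of degree `≤ n` for every `n`. -/
theorem one_mem_soloDegSpan' (c : Fin v → R) (n : ℕ) : (1 : R) ∈ soloDegSpan (F := F) c n :=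
  mem_soloDegSpan_of_aeval c ⟨1, by simp, by simp⟩

end MulSpan

/-! ### The multiplier product trick -/

/-- **Multiplier product trick, generators form** (soloist, quadspan 2.72).  `c : Fin v → R`
(multipliers) and `b : Fin s → R`; `χ` multiplicative and linearly independent; `E` `(2k,h)`-free,
`h ≥ 1`; every `χ e`, `e ∈ E`, in `V_{≤1}·W_{≤1}` (`V_{≤1} = span(1, c)`, `W_{≤1} = span(1, b)`).
Then `C(|E|, k) ≤ C(v+k, k) · C(s+k, k)`. -/
theorem soloInformed_multiplierTrick {F : Type*} [Field F] {R : Type*} [CommRing R] [Algebra F R]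
    {v s : ℕ} (c : Fin v → R) (b : Fin s → R) (χ : ℕ → R) (h0 : χ 0 = 1)
    (hmul : ∀ x y, χ (x + y) = χ x * χ y) (hli : LinearIndependent F χ) (k h : ℕ) (hh : 1 ≤ h)
    (E : Finset ℕ) (hfree : SoloNatFree (2 * k) h E)
    (hE : ∀ e ∈ E, χ e ∈ soloDegSpan (F := F) c 1 * soloDegSpan (F := F) b 1) :
    (E.card).choose k ≤ (v + k).choose k * (s + k).choose k := by
  classical
  -- the family of `k`-fold products, indexed by the `k`-subsets of `E`
  let σ : ↥(E.powersetCard k) → ℕ := fun S => ∑ e ∈ (S : Finset ℕ), e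
  have hinj : Function.Injective σ := by
    intro S T hST
    exact Subtype.ext (solo_kSubsetSums_injOn_nat k h hh E hfree (Finset.mem_coe.mpr S.2)
      (Finset.mem_coe.mpr T.2) hST)
  have hliΦ : LinearIndependent F (χ ∘ σ) := hli.comp σ hinj
  -- every member of the family lies in `V_{≤k}·W_{≤k}`
  have hVf : Module.Finite F (soloDegSpan (F := F) c k) := by
    unfold soloDegSpan; infer_instance
  have hWf : Module.Finite F (soloDegSpan (F := F) b k) := by
    unfold soloDegSpan; infer_instance
  haveI hPf : Module.Finite F ↥(soloDegSpan (F := F) c k * soloDegSpan (F := F) b k) :=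
    Module.Finite.iff_fg.mpr
      ((Module.Finite.iff_fg.mp hVf).mul (Module.Finite.iff_fg.mp hWf))
  have hPdim : finrank F ↥(soloDegSpan (F := F) c k * soloDegSpan (F := F) b k) ≤
      (v + k).choose k * (s + k).choose k :=
    (solo_finrank_mul_le _ _).trans
      (Nat.mul_le_mul (finrank_soloDegSpan_le c k) (finrank_soloDegSpan_le b k))
  set P : Submodule F R := soloDegSpan (F := F) c k * soloDegSpan (F := F) b k with hP
  have hmem : ∀ S : ↥(E.powersetCard k), (χ ∘ σ) S ∈ P := by
    intro S
    have hS : (S : Finset ℕ) ∈ E.powersetCard k := S.2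
    rw [mem_powersetCard] at hS
    simp only [Function.comp_apply, σ]
    rw [solo_chi_sum χ h0 hmul, hP]
    have h := solo_prod_mem_mulDegSpan (F := F) c b χ (S : Finset ℕ)
      (fun e he => hE e (hS.1 he))
    rw [hS.2] at h
    exact h
  let Φ : ↥(E.powersetCard k) → P := fun S => ⟨(χ ∘ σ) S, hmem S⟩
  have hliP : LinearIndependent F Φ := by
    apply LinearIndependent.of_comp P.subtype
    exact hliΦ
  have h1 : Fintype.card ↥(E.powersetCard k) ≤ finrank F P := hliP.fintype_card_le_finrank
  have h4 : Fintype.card ↥(E.powersetCard k) = (E.card).choose k := by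
    rw [Fintype.card_coe, card_powersetCard]
  omega

/-- **Multiplier product trick, subspace form.**  `V, W ⊂ R` finite-dimensional; `χ`
multiplicative and linearly independent; `E` `(2k,h)`-free, `h ≥ 1`; every `χ e`, `e ∈ E`, in
`W + V·W`.  Then `C(|E|, k) ≤ C(dim V + k, k) · C(dim W + k, k)`. -/
theorem soloInformed_multiplierTrick_submodule {F : Type*} [Field F] {R : Type*} [CommRing R]
    [Algebra F R] (V W : Submodule F R) [Module.Finite F V] [Module.Finite F W]
    (χ : ℕ → R) (h0 : χ 0 = 1) (hmul : ∀ x y, χ (x + y) = χ x * χ y)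
    (hli : LinearIndependent F χ) (k h : ℕ) (hh : 1 ≤ h) (E : Finset ℕ)
    (hfree : SoloNatFree (2 * k) h E) (hE : ∀ e ∈ E, χ e ∈ W ⊔ V * W) :
    (E.card).choose k ≤ (finrank F V + k).choose k * (finrank F W + k).choose k := by
  classical
  set c : Fin (finrank F V) → R := fun i => (Module.finBasis F V i : R) with hc
  set b : Fin (finrank F W) → R := fun i => (Module.finBasis F W i : R) with hb
  have hV : V ≤ soloDegSpan (F := F) c 1 := solo_le_soloDegSpan_finBasis V
  have hW : W ≤ soloDegSpan (F := F) b 1 := solo_le_soloDegSpan_finBasis W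
  have hle : W ⊔ V * W ≤ soloDegSpan (F := F) c 1 * soloDegSpan (F := F) b 1 := by
    refine sup_le ?_ ?_
    · intro y hy
      simpa using Submodule.mul_mem_mul (one_mem_soloDegSpan' (F := F) c 1) (hW hy)
    · exact Submodule.mul_le.2 fun m hm n hn => Submodule.mul_mem_mul (hV hm) (hW hn)
  exact soloInformed_multiplierTrick c b χ h0 hmul hli k h hh E hfree fun e he => hle (hE e he)

/-! ### Univariate corollaries: hubs are light -/

/-- The monomials `X^n` are linearly independent in `F[X]`. -/
theorem solo_linearIndependent_X_pow (F : Type*) [Field F] :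
    LinearIndependent F (fun n : ℕ => (Polynomial.X : F[X]) ^ n) := by
  have hfun : (fun n : ℕ => (Polynomial.X : F[X]) ^ n) = ⇑(Polynomial.basisMonomials F) := by
    funext n
    simp [Polynomial.coe_basisMonomials, Polynomial.X_pow_eq_monomial]
  rw [hfun]
  exact (Polynomial.basisMonomials F).linearIndependent

/-- **Pencil hubs are light.**  Hubs `q_a`, `a ∈ B`, acting on one subspace `W ⊂ F[X]`; every
`X^e`, `e ∈ E`, on some pencil: `q_a * x = w + X^e` with `x, w ∈ W`; `E` `(2k,h)`-free, `h ≥ 1`.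
Then `C(|E|, k) ≤ C(|B|+k, k) · C(dim W + k, k)` — for `|B|` bounded and `k → ∞`,
`|E| ≤ (1 + o(1))·dim W` in total over all hubs. -/
theorem soloInformed_multiplierTrick_pencils {F : Type*} [Field F] {ι : Type*} (B : Finset ι)
    (W : Submodule F F[X]) [FiniteDimensional F W] (q : ι → F[X]) (E : Finset ℕ) {k h : ℕ}
    (hh : 1 ≤ h) (hfree : SoloNatFree (2 * k) h E)
    (hreal : ∀ e ∈ E, ∃ a ∈ B, ∃ x ∈ W, ∃ w ∈ W, q a * x = w + Polynomial.X ^ e) :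
    (E.card).choose k ≤ (B.card + k).choose k * (finrank F W + k).choose k := by
  classical
  set V : Submodule F F[X] := Submodule.span F ((B.image q : Finset F[X]) : Set F[X]) with hV
  have hmem : ∀ e ∈ E, (Polynomial.X : F[X]) ^ e ∈ W ⊔ V * W := by
    intro e he
    obtain ⟨a, ha, x, hx, w, hw, hqx⟩ := hreal e he
    have hxe : (Polynomial.X : F[X]) ^ e = -w + q a * x := by rw [hqx]; ring
    rw [hxe]
    exact Submodule.add_mem_sup (W.neg_mem hw) (Submodule.mul_mem_mul
      (Submodule.subset_span (Finset.mem_coe.mpr (Finset.mem_image_of_mem q ha))) hx)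
  have hfin : finrank F V ≤ B.card :=
    (finrank_span_finset_le_card (R := F) (B.image q)).trans Finset.card_image_le
  have hmain := soloInformed_multiplierTrick_submodule V W (fun n => (Polynomial.X : F[X]) ^ n)
    (pow_zero _) (fun _ _ => pow_add _ _ _) (solo_linearIndependent_X_pow F) k h hh E hfree hmem
  exact hmain.trans (Nat.mul_le_mul (Nat.choose_le_choose k (by omega)) le_rfl)

/-- **Rank-2 columns are light.**  Columns `(p_a, q_a)`, `a ∈ B`, acting on one subspace
`W ⊂ F[X]`; every `X^e`, `e ∈ E`, realised by some column: `X^e = p_a * x + q_a * y` with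
`x, y ∈ W`; `E` `(2k,h)`-free, `h ≥ 1`.  Then `C(|E|, k) ≤ C(2|B|+k, k) · C(dim W + k, k)`:
the free values incident to a column set `B` number `≤ k + (dim W + k)·C(2|B|+k,k)^{1/k}`
(`≲ 2e·|B|·dim W / k` for `|B| ≫ k`; `(1+o(1))·dim W` for `|B|` bounded, `k → ∞`). -/
theorem soloInformed_multiplierTrick_columns {F : Type*} [Field F] {ι : Type*} (B : Finset ι)
    (W : Submodule F F[X]) [FiniteDimensional F W] (p q : ι → F[X]) (E : Finset ℕ) {k h : ℕ}
    (hh : 1 ≤ h) (hfree : SoloNatFree (2 * k) h E)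
    (hreal : ∀ e ∈ E, ∃ a ∈ B, ∃ x ∈ W, ∃ y ∈ W,
      (Polynomial.X : F[X]) ^ e = p a * x + q a * y) :
    (E.card).choose k ≤ (2 * B.card + k).choose k * (finrank F W + k).choose k := by
  classical
  set SV : Finset F[X] := B.image p ∪ B.image q with hSV
  set V : Submodule F F[X] := Submodule.span F (SV : Set F[X]) with hV
  have hmem : ∀ e ∈ E, (Polynomial.X : F[X]) ^ e ∈ W ⊔ V * W := by
    intro e he
    obtain ⟨a, ha, x, hx, y, hy, hxe⟩ := hreal e he
    rw [hxe]
    refine Submodule.mem_sup_right (Submodule.add_mem _ ?_ ?_)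
    · exact Submodule.mul_mem_mul (Submodule.subset_span (Finset.mem_coe.mpr
        (Finset.mem_union_left _ (Finset.mem_image_of_mem p ha)))) hx
    · exact Submodule.mul_mem_mul (Submodule.subset_span (Finset.mem_coe.mpr
        (Finset.mem_union_right _ (Finset.mem_image_of_mem q ha)))) hy
  have hfin : finrank F V ≤ 2 * B.card := by
    have h1 : finrank F V ≤ SV.card := finrank_span_finset_le_card (R := F) SV
    have h2 : SV.card ≤ (B.image p).card + (B.image q).card := Finset.card_union_le _ _
    have h3 : (B.image p).card ≤ B.card := Finset.card_image_le
    have h4 : (B.image q).card ≤ B.card := Finset.card_image_le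
    omega
  have hmain := soloInformed_multiplierTrick_submodule V W (fun n => (Polynomial.X : F[X]) ^ n)
    (pow_zero _) (fun _ _ => pow_add _ _ _) (solo_linearIndependent_X_pow F) k h hh E hfree hmem
  exact hmain.trans (Nat.mul_le_mul (Nat.choose_le_choose k (by omega)) le_rfl)

end Summit.ValiantsHypothesis.ValiantsHypothesis.Theorems
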